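import Mathlib
import Summits.MatrixMultiplication.MatrixMultiplication.Theorems.SnSubsetDichotomyNoThresholdSubsetTriplePlancherelGrowthDefs
import Summits.MatrixMultiplication.MatrixMultiplication.Theorems.SnSubsetDichotomyNoThresholdSubsetTriplePlancherelStepDefs

/-!
# Basic facts of the uniform measure on tableau pairs and of the prefix filtration

Line `klr-graded-polynomial-method`, crux `SnSubsetDichotomy.NoThresholdSubsetTriple` (stmt-MatrixMultiplication-8302),
stub `pairMeasure_basic` (MODEL theorem, basics): for the uniform measure `pairMeasure n = (n!)⁻¹ • count` on the
same-shape pairs of standard Young tableaux with `n` cells (`TableauPair n`, `Nat.card = n!` by `card_tableauPair`) and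
the prefix filtration `ℱ_t = comap (prefixKey n t) ⊤` (tree `PlancherelGrowthDefs`):

* `pairMeasure n` is a probability measure (`pairMeasure_univ`);
* `(pairMeasure n).real {ω | P ω} = #{ω // P ω} / n!` — the dictionary between the route's counting statements and
  probabilities;
* every function of the prefix shape `shapeBefore (ω.2.2).1 t` (the cells of the entries `< t` of the second tableau) is
  strongly `ℱ_t`-measurable, because the prefix shape is a function of the prefix key:
  `shapeBefore (ω.2.2).1 t = ⋃ k, (prefixKey n t ω k).toFinset`.
-/

open MeasureTheory ProbabilityTheory
open scoped BigOperators ENNReal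
open Literature.RepresentationTheory.FiniteGroups (addableNodes IsAddableNode TableauPair)
open Literature.NumberTheory.DiophantineGeometry (StdFilling)

namespace Summit.MatrixMultiplication.MatrixMultiplication.Theorems

open PlancherelStep PlancherelGrowth

set_option linter.dupNamespace false in
/-- Any function factoring through `g` is measurable for the σ-algebra `comap g ⊤` generated by `g`
(the preimage of `s` under `h ∘ g` is the `g`-preimage of the (`⊤`-measurable) set `h ⁻¹' s`). -/
private theorem measurable_comap_top_comp {α β γ : Type*} [MeasurableSpace γ] (g : α → β) (h : β → γ) :
    Measurable[MeasurableSpace.comap g ⊤] (h ∘ g) := by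
  intro s _
  exact MeasurableSpace.measurableSet_comap.2 ⟨h ⁻¹' s, MeasurableSpace.measurableSet_top, rfl⟩

set_option linter.dupNamespace false in
/-- The prefix shape is a function of the prefix key: the cells of the entries `< t` of the second tableau are the
values `some _` of `prefixKey n t ω`. -/
private theorem shapeBefore_eq_biUnion_prefixKey {n : ℕ} (t : ℕ) (ω : TableauPair n) :
    shapeBefore (ω.2.2).1 t = Finset.univ.biUnion fun k => (prefixKey n t ω k).toFinset := by
  ext x
  simp only [shapeBefore, Finset.mem_image, Finset.mem_filter, Finset.mem_univ, true_and, Finset.mem_biUnion,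
    Option.mem_toFinset, Option.mem_def, prefixKey, Option.ite_none_right_eq_some, Option.some.injEq]

set_option linter.dupNamespace false in
/-- **Basic facts of the uniform measure / prefix filtration on tableau pairs** (stub `pairMeasure_basic` of line
`klr-graded-polynomial-method`, crux `SnSubsetDichotomy.NoThresholdSubsetTriple`; MODEL theorem basics).
`pairMeasure n = (n!)⁻¹ • count` is a probability measure on `TableauPair n`; the probability of an event is its
cardinality over `n!`; and every function of the prefix shape `shapeBefore (ω.2.2).1 t` of the second tableau is
strongly measurable for the prefix σ-algebra `ℱ_t = prefixFiltration n t` (it factors through the prefix key). -/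
theorem pairMeasure_basic : ∀ (n : ℕ),
    IsProbabilityMeasure (pairMeasure n) ∧
    (∀ (P : TableauPair n → Prop), (pairMeasure n).real {ω | P ω} = (Nat.card {ω : TableauPair n // P ω} : ℝ) / n.factorial) ∧
    (∀ (t : ℕ) (φ : Finset (ℕ × ℕ) → ℝ),
      StronglyMeasurable[prefixFiltration n t] (fun ω : TableauPair n => φ (shapeBefore (ω.2.2).1 t))) := by
  intro n
  refine ⟨⟨pairMeasure_univ n⟩, fun P => ?_, fun t φ => ?_⟩
  · have hs : ({ω | P ω} : Set (TableauPair n)).Finite := Set.toFinite _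
    rw [measureReal_def, pairMeasure, Measure.smul_apply, smul_eq_mul, Measure.count_apply_finite _ hs,
      ← Nat.card_eq_card_finite_toFinset hs, ENNReal.toReal_mul, ENNReal.toReal_inv, ENNReal.toReal_natCast,
      ENNReal.toReal_natCast, div_eq_inv_mul]
    rfl
  · have hfac : (fun ω : TableauPair n => φ (shapeBefore (ω.2.2).1 t)) =
        (fun κ : Fin n → Option (ℕ × ℕ) => φ (Finset.univ.biUnion fun k => (κ k).toFinset)) ∘ prefixKey n t := by
      funext ω
      simp only [Function.comp_apply, shapeBefore_eq_biUnion_prefixKey]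
    rw [hfac]
    exact (measurable_comap_top_comp (prefixKey n t) _).stronglyMeasurable

end Summit.MatrixMultiplication.MatrixMultiplication.Theorems
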